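import Summits.ResolutionOfSingularities.ResolutionOfSingularities.Theorems.EquisingularLiftEquisingularLiftNatFirstOrderPointsMatrix
import Summits.ResolutionOfSingularities.ResolutionOfSingularities.Theorems.EquisingularLiftEquisingularLiftBlowupModelCubicSurfaceOrdinaryPoints
import HarnessLib

/-!
# [OURS] ★★★ REGULAR BLOW-UP MODELS FOR CUBIC SURFACES WHOSE SINGULAR POINTS ARE FIRST-ORDER (A₁, A₂, characteristic-2 nodes) — every characteristic;
# the residual of `EquisingularLift` (stmt-…-15660) RE-CUT BY NAME

[OURS · leafhand-res-equisingularlift-9 g0, 2026-08-31; cell `pub/decomp-res`; item stmt-…-15660] AI-produced, weaker than expert review; NOT a statement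
of any manuscript; nothing here proves resolution of singularities in positive characteristic.  DEF-FREE; no `sorry`; standard axioms; ZERO named
hypotheses.

The companion of `…NatCubicSurfaceFirstOrderPoints` in the currency of crux 15660 («`∃ 𝔞 ≠ ⊥` on `H` all of whose blow-ups are regular» = «`H` has a
projective resolution», ✓ `blowupModel_iff_projectiveResolution`), weakening leafhand-8's ✓ `blowupModel_of_cubic_ordinary` from ORDINARY to FIRST-ORDER
singular points (✓ `StrataSplit.blowupModel_of_firstOrderPoints_matrix₂`):

* ★★★ `StrataSplit.blowupModel_of_cubic_firstOrder` — `K = K̄`; `ι : H ↪ ℙ³_K` a closed immersion, `H` integral, `range ι = V₊(F)`, `F` a prime cubic form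
  all of whose singular points are first-order (translated chart `Φ + (Ψ₁ + Ψ')`, `Φ(v) = ∇Φ(v) = Ψ₁(v) = 0` only for `v = 0`): `H` has a regular blow-up
  model — every cubic surface with only `A₁`/`A₂` points, every characteristic (submaximal-line cubics inside);
* ★ `StrataSplit.equisingularLift_of_forall_blowupModel_off_cubicFirstOrder` — `Theses.EquisingularLift.EquisingularLift` BY NAME from regular blow-up
  models at the `(H, ι)` with `n ≥ 3`, `H` not regular, `range ι = V₊(F)`, `F` prime of degree `e ≥ 3`, such that IF `n = 3 = e` some singular vector admits
  no first-order datum.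

Honest label: closes no registered stub; `stub_blowupModel_ge_five` stays OPEN.
-/

set_option linter.dupNamespace false -- mandated namespace `Summit.<Summit>.<Problem>` of this single-conjunct summit

noncomputable section

open CategoryTheory CategoryTheory.Limits AlgebraicGeometry TopologicalSpace
open MvPolynomial
open Literature.AlgebraicGeometry.Resolution
open Literature.AlgebraicGeometry.Motives Literature.AlgebraicGeometry.Motives.SmoothHypersurface
open Literature.AlgebraicGeometry.Motives.ProjectiveSpace
open AlgebraicGeometry.Scheme.IdealSheafData

namespace Summit.ResolutionOfSingularities.ResolutionOfSingularities.Cruxes.EquisingularLift.StrataSplit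

open Summit.ResolutionOfSingularities.ResolutionOfSingularities.Cruxes.EquisingularLiftNat.Sections

/-- ★★★ **REGULAR BLOW-UP MODELS FOR INTEGRAL CUBIC SURFACES WHOSE SINGULAR POINTS ARE FIRST-ORDER POINTS — every characteristic** (`K = K̄`):
`ι : H ↪ ℙ³_K` a closed immersion, `H` integral, `range ι = V₊(F)`, `F` a prime cubic form with the (fo) hypothesis of
✓ `CubicNodes.elNatAt_of_cubic_firstOrder` ⟹ `∃ 𝔞 ≠ ⊥` on `H` all of whose blow-ups are regular (conclusion of the OPEN residual `stub_blowupModel_ge_five`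
at `H`).  Submaximal-line cubics via ✓ `exists_closedImmersion_range_eq_of_linSubst` + ✓ `blowupModel_of_range_eq_of_mem_pow`; the rest via
✓ `CubicNodes.exists_normalized_matrix_of_singular` + ✓ `blowupModel_of_firstOrderPoints_matrix₂`. [cite: Hartshorne1977, I Ex. 5.8, II Example 7.1.1, II Ex. 7.12] -/
theorem blowupModel_of_cubic_firstOrder {K : Type} [Field K] [IsAlgClosed K] {H : Scheme.{0}}
    (ι : H ⟶ (projectiveSpace (1 + 1 + 1) K).left) [IsClosedImmersion ι] [IsIntegral H]
    (F : MvPolynomial (Fin (1 + 1 + 1 + 1)) K) (hF : F.IsHomogeneous 3) (hprime : Prime F)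
    (hrange : letI := MvPolynomial.gradedAlgebra (σ := Fin (1 + 1 + 1 + 1)) (R := K)
      Set.range ι = {x : Proj (homogeneousSubmodule (Fin (1 + 1 + 1 + 1)) K) | F ∈ x.asHomogeneousIdeal})
    (hfo : ∀ (b : Fin (1 + 2 + 1) → K) (c₀ : Fin (1 + 2 + 1)), b c₀ = 1 → eval b F = 0 → (∀ j, eval b (pderiv j F) = 0) →
      ∃ (μ : ℕ) (Φ Ψ₁ Ψ' : MvPolynomial (Fin (1 + 2)) K), 1 ≤ μ ∧ Φ.IsHomogeneous μ ∧ Φ ≠ 0 ∧ Ψ₁.IsHomogeneous (μ + 1) ∧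
        Ψ' ∈ Ideal.span (Set.range (X : Fin (1 + 2) → MvPolynomial (Fin (1 + 2)) K)) ^ (μ + 2) ∧
        aeval (fun j : Fin (1 + 2) => (X j : MvPolynomial (Fin (1 + 2)) K) + C (b (c₀.succAbove j))) (ProjectiveSpace.dehomogenize K c₀ F) =
          Φ + (Ψ₁ + Ψ') ∧
        ∀ v : Fin (1 + 2) → K, aeval v Φ = 0 → (∀ i, aeval v (pderiv i Φ) = 0) → aeval v Ψ₁ = 0 → v = 0) :
    ∃ 𝔞 : H.IdealSheafData, 𝔞 ≠ ⊥ ∧ ∀ (Z : Scheme.{0}) (π : Z ⟶ H), IsBlowup π 𝔞 → Scheme.IsRegular Z := by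
  classical
  by_cases hsm : ∃ B : Matrix (Fin 4) (Fin 4) K, IsUnit B.det ∧ aeval B.toMvPolynomial F ∈ (Ideal.span {(X 2 : MvPolynomial (Fin 4) K), X 3}) ^ 2
  · obtain ⟨B, hB, hmem⟩ := hsm
    obtain ⟨ι₁, hι₁, hrange₁⟩ := exists_closedImmersion_range_eq_of_linSubst (B⁻¹).toMvPolynomial B.toMvPolynomial
      (Matrix.toMvPolynomial_isHomogeneous _) (Matrix.toMvPolynomial_isHomogeneous _)
      (MultiOrd.aeval_toMvPolynomial_inv_toMvPolynomial B hB) (MultiOrd.aeval_toMvPolynomial_toMvPolynomial_inv B hB) ι F hrange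
    haveI := hι₁
    exact blowupModel_of_range_eq_of_mem_pow (d := 1) ι₁ (aeval B.toMvPolynomial F) (Literature.AlgebraicGeometry.ProjectiveSpace.IsHomogeneous.aeval_toMvPolynomial B hF)
      (SubmaxLine.prime_aeval_of_prime (B⁻¹).toMvPolynomial B.toMvPolynomial
        (MultiOrd.aeval_toMvPolynomial_inv_toMvPolynomial B hB) (MultiOrd.aeval_toMvPolynomial_toMvPolynomial_inv B hB) hprime) hmem hrange₁
  · push Not at hsm
    obtain ⟨B, S, c₀, hB, hS, hB1, hsing, hcov⟩ := CubicNodes.exists_normalized_matrix_of_singular hF hprime hsm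
    exact blowupModel_of_firstOrderPoints_matrix₂ (m := 1) ι F hF hprime hrange B hB S hS c₀ (fun c _ => hB1 c)
      (fun c hc => hfo (fun l => B l c) (c₀ c) (hB1 c) (hsing c hc).1 (hsing c hc).2) hcov

/-- ★ **`Theses.EquisingularLift.EquisingularLift` (stmt-…-15660) RE-CUT BY NAME off the cubic surfaces with only first-order singular points**: regular
blow-up models are needed only for the `(H, ι)` of the crux (`n ≥ 3`, `H` not regular, `range ι = V₊(F)`, `F` a prime form of degree `e ≥ 3`) such that,
IF `n = 3` and `e = 3`, some singular vector `b` (`b_{c₀} = 1`) of `F` admits no first-order datum.  Everything else — regular `H`, degree `≤ 2` (lh6 g3),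
cubic surfaces with first-order singular points (this file) — is in the tree in every characteristic. [OURS · lh9 · DEF-FREE · pure reduction]
[cite: Hartshorne1977, I Ex. 5.8, II Ex. 7.12] -/
theorem equisingularLift_of_forall_blowupModel_off_cubicFirstOrder
    (h : ∀ p : ℕ, p.Prime → ∀ (k : Type) [Field k] [CharP k p] [IsAlgClosed k] (n : ℕ) (H : Scheme.{0})
      (ι : H ⟶ (Literature.AlgebraicGeometry.Motives.projectiveSpace n k).left), IsClosedImmersion ι → IsIntegral H →
      (∀ y : (Literature.AlgebraicGeometry.Motives.projectiveSpace n k).left,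
        ∃ U : (Literature.AlgebraicGeometry.Motives.projectiveSpace n k).left.affineOpens,
          y ∈ (U : (Literature.AlgebraicGeometry.Motives.projectiveSpace n k).left.Opens) ∧ (ι.ker.ideal U).IsPrincipal) →
      3 ≤ n → ¬ Scheme.IsRegular H → ∀ (e : ℕ) (F : MvPolynomial (Fin (n + 1)) k), 3 ≤ e → F.IsHomogeneous e → Prime F →
      (letI := MvPolynomial.gradedAlgebra (σ := Fin (n + 1)) (R := k)
       Set.range ι = {x : Proj (homogeneousSubmodule (Fin (n + 1)) k) | F ∈ x.asHomogeneousIdeal}) →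
      (∀ hn : n = 3, e = 3 → ∃ (b : Fin (n + 1) → k) (c₀ : Fin (n + 1)), b c₀ = 1 ∧ eval b F = 0 ∧ (∀ j, eval b (pderiv j F) = 0) ∧
        ∀ (μ : ℕ) (Φ Ψ₁ Ψ' : MvPolynomial (Fin n) k), 1 ≤ μ → Φ.IsHomogeneous μ → Φ ≠ 0 → Ψ₁.IsHomogeneous (μ + 1) →
          Ψ' ∈ Ideal.span (Set.range (X : Fin n → MvPolynomial (Fin n) k)) ^ (μ + 2) →
          (∀ v : Fin n → k, aeval v Φ = 0 → (∀ i, aeval v (pderiv i Φ) = 0) → aeval v Ψ₁ = 0 → v = 0) →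
          aeval (fun j : Fin n => (X j : MvPolynomial (Fin n) k) + C (b (c₀.succAbove j))) (ProjectiveSpace.dehomogenize k c₀ F) ≠ Φ + (Ψ₁ + Ψ')) →
      ∃ 𝔞 : H.IdealSheafData, 𝔞 ≠ ⊥ ∧ ∀ (Z : Scheme.{0}) (π : Z ⟶ H), IsBlowup π 𝔞 → Scheme.IsRegular Z) :
    Summit.ResolutionOfSingularities.ResolutionOfSingularities.Theses.EquisingularLift.EquisingularLift := by
  refine equisingularLift_of_primeForms ?_
  intro p hp k _ _ _ n H ι hι hH hloc hn e F he hF hprime hrange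
  haveI := hι
  haveI := hH
  refine EL_of_blowupModel_all p hp k n H ι hι hH hloc ?_
  by_cases hreg : Scheme.IsRegular H
  · exact exists_blowupModel_of_isRegular hreg
  by_cases he2 : e ≤ 2
  · obtain ⟨r, rfl⟩ : ∃ r, n = r + 1 + 1 := ⟨n - 2, by omega⟩
    exact QuadricELNat.blowupModel_of_range_eq_of_degree_le_two ι F hF he2 hprime hrange
  have he3 : 3 ≤ e := by omega
  by_cases hgood : ∃ (hn : n = 3), e = 3 ∧ ∀ (b : Fin (n + 1) → k) (c₀ : Fin (n + 1)), b c₀ = 1 → eval b F = 0 →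
      (∀ j, eval b (pderiv j F) = 0) →
      ∃ (μ : ℕ) (Φ Ψ₁ Ψ' : MvPolynomial (Fin n) k), 1 ≤ μ ∧ Φ.IsHomogeneous μ ∧ Φ ≠ 0 ∧ Ψ₁.IsHomogeneous (μ + 1) ∧
        Ψ' ∈ Ideal.span (Set.range (X : Fin n → MvPolynomial (Fin n) k)) ^ (μ + 2) ∧
        (∀ v : Fin n → k, aeval v Φ = 0 → (∀ i, aeval v (pderiv i Φ) = 0) → aeval v Ψ₁ = 0 → v = 0) ∧
        aeval (fun j : Fin n => (X j : MvPolynomial (Fin n) k) + C (b (c₀.succAbove j))) (ProjectiveSpace.dehomogenize k c₀ F) = Φ + (Ψ₁ + Ψ')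
  · obtain ⟨rfl, rfl, hall⟩ := hgood
    refine blowupModel_of_cubic_firstOrder (K := k) ι F hF hprime hrange fun b c₀ hb1 hb0 hbd => ?_
    obtain ⟨μ, Φ, Ψ₁, Ψ', h1, h2, h3, h4, h5, h6, h7⟩ := hall b c₀ hb1 hb0 hbd
    exact ⟨μ, Φ, Ψ₁, Ψ', h1, h2, h3, h4, h5, h7, h6⟩
  · refine h p hp k n H ι hι hH hloc hn hreg e F he3 hF hprime hrange fun hn he => ?_
    have hno : ¬ ∀ (b : Fin (n + 1) → k) (c₀ : Fin (n + 1)), b c₀ = 1 → eval b F = 0 → (∀ j, eval b (pderiv j F) = 0) →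
        ∃ (μ : ℕ) (Φ Ψ₁ Ψ' : MvPolynomial (Fin n) k), 1 ≤ μ ∧ Φ.IsHomogeneous μ ∧ Φ ≠ 0 ∧ Ψ₁.IsHomogeneous (μ + 1) ∧
          Ψ' ∈ Ideal.span (Set.range (X : Fin n → MvPolynomial (Fin n) k)) ^ (μ + 2) ∧
          (∀ v : Fin n → k, aeval v Φ = 0 → (∀ i, aeval v (pderiv i Φ) = 0) → aeval v Ψ₁ = 0 → v = 0) ∧
          aeval (fun j : Fin n => (X j : MvPolynomial (Fin n) k) + C (b (c₀.succAbove j))) (ProjectiveSpace.dehomogenize k c₀ F) = Φ + (Ψ₁ + Ψ') :=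
      fun hall => hgood ⟨hn, he, hall⟩
    push Not at hno
    obtain ⟨b, c₀, hb1, hb0, hbd, hnone⟩ := hno
    exact ⟨b, c₀, hb1, hb0, hbd, fun μ Φ Ψ₁ Ψ' h1 h2 h3 h4 h5 h6 => hnone μ Φ Ψ₁ Ψ' h1 h2 h3 h4 h5 h6⟩

end Summit.ResolutionOfSingularities.ResolutionOfSingularities.Cruxes.EquisingularLift.StrataSplit

end
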